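import Mathlib
import HarnessLib
import Summits.CriticalPhenomena.CardyFormulaZ2.Theses.CardySelfDualSegment
import Literature.Probability.Percolation.CornerPercolation
import Literature.Barriers.CriticalPhenomena.EmbeddingModulusUniquenessProofs
import Literature.Probability.RandomPlanarGeometry.ConformalRectangleProofs
import Literature.Probability.RandomPlanarGeometry.CardyFunction
import Summits.CriticalPhenomena.CardyFormulaZ2.Theorems.CardySelfDualSegmentSegmentOpenSmirnovGermForm
import Summits.CriticalPhenomena.CardyFormulaZ2.Theorems.CardySelfDualSegmentSegmentOpenCruxIffNoIsolated
import Summits.CriticalPhenomena.CardyFormulaZ2.Theorems.CardySelfDualSegmentSegmentClosed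
import Summits.CriticalPhenomena.CardyFormulaZ2.Theorems.CardySelfDualSegmentSegmentOpenIffTarget

/-!
# Crux `SegmentOpen` (stmt-CriticalPhenomena-5471) — line `Sketch`, lead skeleton (lead c9, reshape 9: SPLIT FORM)

Line `Sketch` (crux-ideate r1, ideator 1; card B `vitali-transfer-smirnov-germ` is the spine).  Everything the
previous leads 0–c8 landed stays (kernel-checked, see `Lines/Sketch.lean` @ reshape 8 for the list, p97364 …
p155980).

RESHAPE 9 (lead c9, 2026-08-17) = the SPLIT FORM certified by redirect-strategist r1
(`Cruxes/SegmentOpen/SplitR1_Sketch.lean`, `…NearSmirnovBirth.lean`, `…GermPropagationBirth.lean`, STRATEGY-CENSUS-r1,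
BC7 probes clean for both children):

    SegmentOpen ⇐ NearSmirnov ∧ GermPropagation,
    NearSmirnov      (∃ ε > 0, ∀ t < ε, t ∈ G)     ⇐ S4wP|rect + JCR + JIR₀   via the glue stub NGT,
    GermPropagation  (NearSmirnov → UM → IsOpen G) ⇐ S4wP + UBC + AIT         via `segmentClosed_proof`
                                                                                + the clopen sweep.

Compared with reshape 8 (S4wR / JCR / JIR with ONE GLOBAL real-analytic modulus curve on `[0,1]`):
* the identification stub is LOCALISED at the Smirnov point — JIR₀ `stub_jetIdentificationRectLocal` asks for a
  modulus GERM `α` on `[0,r₀)` (a bare function into `ℍ`) whose sheared Cardy values sum the perturbation series of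
  the coefficient limits; nothing at `t ≥ r₀`, no analyticity of `α`, no pinning at `t = 1`;
* propagation along the segment is no longer carried by a posited global curve but PROVED from tame analyticity:
  `G` is closed (PROVED `segmentClosed_proof`, fed by UBC and by the crux hypothesis UM — which is therefore no
  longer idle), accumulation points of `G` inside `G` are interior points (AIT, provable now: Vitali on a disc-chain
  neighbourhood of `[0,1]` per polygonal test domain, the diamond chart `exists_diamond_shear_chart`, the identity
  theorem, the rectilinear-to-wild transport (W) `HeatFlow.cardyLimit_of_rectilinear` p137344), `0` is an
  accumulation point of `G` (from NearSmirnov), and `SmirnovGerm.eq_univ_of_isClosed_of_accPt` sweeps;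
* the analyticity stub is the POLYGONAL one, S4wP (boundary covered by finitely many straight segments of any
  direction — the diamond chart domain is polygonal, not rectilinear), with `R`-dependent radius and mesh threshold
  (no uniform-in-`R` radius: the strategist's A0 is avoided by NGT, which runs Vitali-with-jets on a disc-chain
  neighbourhood of the whole segment and the identity theorem on `[0, r₀)` only);
* UBC = the sibling crux `UniformBoxCrossing` (stmt-CriticalPhenomena-5476) BY NAME.

Registered stubs (6 ≤ stubs_max 7): S4wP `stub_localComplexBoundPolygonal` (research), JCR `stub_jetConvRect`
(research, verbatim reshape 8), JIR₀ `stub_jetIdentificationRectLocal` (research, HELD BY THE LEAD), UBC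
`stub_uniformBoxCrossing` (= crux 5476), AIT `stub_accumulationInteriorOfTameAnalyticity` (provable, wave 1),
NGT `stub_nearGoodOfTameJets` (provable glue, wave 1).  All stub statements are in TREE VOCABULARY ONLY (the good
set and the rectilinear / polygonal hypotheses are inlined verbatim as in `SmirnovGermForm` /
`HeatFlow.cardyLimit_of_rectilinear`), so that a worker's file restates them byte-for-byte.

The research kernel is unchanged and sits where the census put it: JIR₀ ⊇ JCR(k=1) ⊇ K = order-1 marginality +
identification at the Smirnov point (O1 p137160, Order1Census.md, Order1Test.md: a₁ saturates, θ′(0) = 0.3930(23)).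
-/

noncomputable section

namespace Summit.CriticalPhenomena.CardyFormulaZ2.Theorems

open Literature.Probability Literature.Barriers.CriticalPhenomena
open Literature.Probability.RandomPlanarGeometry (ConformalRectangle ConformalEquiv MarkedDomain)
open Filter Set Topology MeasureTheory
open UpperHalfPlane (upperHalfPlaneSet)

/-! ## Stubs (tree vocabulary only) -/

/-- S4wP (research).  LOCAL MESH-UNIFORM ANALYTICITY ON POLYGONAL TEST DOMAINS: for each `t₀ ∈ [0,1]` and each
conformal rectangle `R` whose boundary is covered by finitely many straight segments there are a complex radius
`r > 0`, a mesh threshold `δ₁ > 0` and a bound `C` such that the crossing polynomials `p_δ` of `R` (S1) satisfy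
`|p_δ(z)| ≤ C` on `B(t₀, r)` for all `δ < δ₁`.  Lee–Yang type, non-perturbative, NOT a consequence of UM
(`Negative/MarginalNotAnalytic`, `AllOrdersNotAnalytic`); numerically supported with `r ≈ 1` on boxes (exact
transfer matrices `H ≤ 13`, Disproof.lean Numerics); its level-1 content at `t₀` is the Russo bound (B₁) of crux
5472 on tame domains.  The rectilinear sub-case is reshape 8's S4wR; the all-`R` ancestor S4w is very probably
false over wild Jordan rectangles (comb gadgets), which are not polygonal. -/
theorem stub_localComplexBoundPolygonal :
    ∀ (t₀ : unitInterval) (R : ConformalRectangle),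
      (∃ S : Finset (ℂ × ℂ), frontier R.carrier ⊆ ⋃ p ∈ S, segment ℝ p.1 p.2) →
      ∃ r > 0, ∃ δ₁ > 0, ∃ C : ℝ, ∀ δ : ℝ, 0 < δ → δ < δ₁ → ∀ p : Polynomial ℝ,
        (∀ t : unitInterval, Percolation.cornerCrossingProb t R δ = p.eval (t : ℝ)) →
        ∀ z ∈ Metric.ball ((t₀ : ℝ) : ℂ) r, ‖(p.map (algebraMap ℝ ℂ)).eval z‖ ≤ C := by
  sorry

/-- JCR (research; verbatim the reshape-8 stub).  JET CONVERGENCE AT THE SMIRNOV POINT ON TAME DOMAINS: for every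
RECTILINEAR conformal rectangle `R'` and every order `k`, the `k`-th coefficient of the crossing polynomial `p_δ` of
`R'` converges as `δ → 0⁺`.  `k = 0` is Smirnov's theorem (`jetConv_zero`, p134201); `k = 1` is convergence of
the signed level-1 pivotal sum `a₁(δ, R')` of site percolation on `𝕋` (numerically convergent, Order1Test.md;
open). -/
theorem stub_jetConvRect :
    ∀ R' : ConformalRectangle,
      (∃ S : Finset (ℂ × ℂ), (∀ p ∈ S, p.1.re = p.2.re ∨ p.1.im = p.2.im) ∧
        frontier R'.carrier ⊆ ⋃ p ∈ S, segment ℝ p.1 p.2) →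
      ∀ k : ℕ, ∃ a : ℝ, ∀ ε > 0, ∃ δ₀ > 0, ∀ δ : ℝ, 0 < δ → δ < δ₀ → ∀ p : Polynomial ℝ,
        (∀ t : unitInterval, Percolation.cornerCrossingProb t R' δ = p.eval (t : ℝ)) →
        |p.coeff k - a| < ε := by
  sorry

/-- JIR₀ (research, HELD BY THE LEAD; JIR of reshape 8 LOCALISED at the Smirnov point — the identification half of
child `NearSmirnov`).  There are `r₀ > 0` and a modulus germ `α` on `[0, r₀)` with `0 < im α` such that for every
RECTILINEAR `R'`, every real-analytic modulus function `M` of `R'` (S7 provides one) and every sequence `a` of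
coefficient limits of the crossing polynomials of `R'` (JCR), the perturbation series `Σ a_k t^k` sums to the
sheared Cardy value `F(M(α t))` for all `t < r₀`: "all-orders conformal perturbation theory AT the Smirnov point"
on tame domains.  Order 1 = the order-1 rigidity O1 (p137160): `a₁(R') = θ′(0) · ∂_θ F(M_{R'}(e^{iθ}))|_{π/3}`
with ONE constant, measured `θ′(0) = 0.3930(23) ≈ π/8` (Order1Test.md).  Any such germ is pinned at `0`
(`α 0 = ζ`, `‖α‖ = 1` on `[0,r₀)`, Negative/NormOne + FrozenModulus via NGT). -/
theorem stub_jetIdentificationRectLocal :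
    ∃ r₀ > 0, ∃ α : unitInterval → ℂ, (∀ t : unitInterval, (t : ℝ) < r₀ → 0 < (α t).im) ∧
      ∀ R' : ConformalRectangle,
        (∃ S : Finset (ℂ × ℂ), (∀ p ∈ S, p.1.re = p.2.re ∨ p.1.im = p.2.im) ∧
          frontier R'.carrier ⊆ ⋃ p ∈ S, segment ℝ p.1 p.2) →
        ∀ M : ℂ → ℝ, AnalyticOnNhd ℝ M {β : ℂ | 0 < β.im} →
          (∀ β : ℂ, 0 < β.im → ∀ (R : ConformalRectangle)
              (φ : ConformalEquiv UpperHalfPlane.upperHalfPlaneSet R.carrier) (x : Fin 4 → ℝ),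
              R.carrier = moduliShear β '' R'.carrier → (∀ i, R.pt i = moduliShear β (R'.pt i)) →
              R.IsUniformizing φ x → RandomPlanarGeometry.crossRatio x = M β) →
          ∀ a : ℕ → ℝ,
            (∀ k : ℕ, ∀ ε > 0, ∃ δ₀ > 0, ∀ δ : ℝ, 0 < δ → δ < δ₀ → ∀ p : Polynomial ℝ,
                (∀ t : unitInterval, Percolation.cornerCrossingProb t R' δ = p.eval (t : ℝ)) →
                |p.coeff k - a k| < ε) →
            ∀ t : unitInterval, (t : ℝ) < r₀ →
              HasSum (fun k : ℕ => a k * (t : ℝ) ^ k) (RandomPlanarGeometry.cardyFunction (M (α t))) := by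
  sorry

/-- UBC = the sibling crux `UniformBoxCrossing` (stmt-CriticalPhenomena-5476) BY NAME: the t-uniform box-crossing
property of the corner family (needed only through the PROVED `segmentClosed_proof`, for closedness of `G`). -/
theorem stub_uniformBoxCrossing :
    Summit.CriticalPhenomena.CardyFormulaZ2.Theses.CardySelfDualSegment.UniformBoxCrossing := by
  sorry

/-- AIT (provable-now adaptation of S5′ `stub_accumulationInteriorGood` p125317; wave 1).  ACCUMULATION ⇒
INTERIOR AT GOOD POINTS FROM TAME ANALYTICITY: under S4wP (hypothesis, verbatim `stub_localComplexBoundPolygonal`),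
every good point `t₀` of `G = {t | ∃ α ∈ ℍ, CardyMod t α}` that is an accumulation point of `G` is an interior
point of `G`.  Route: good points `u n → t₀`, `u n ≠ t₀`; for each POLYGONAL `R'`, S4wP at every point of
`[0,1]` + compactness give a disc-chain neighbourhood `U ⊇ [0,1]` on which the complex crossing polynomials (S1)
are uniformly bounded for small meshes, and Vitali (`Literature.Analysis.Complex.VitaliConvergence` / VJ p132875:
convergence at the `u n` accumulating at `t₀ ∈ U`) gives a limit `g_{R'}`, real-analytic on `[0,1]`, with
`P_t(R', δ) → g_{R'}(t)` for EVERY `t ∈ [0,1]`; the diamond chart (`exists_diamond_shear_chart`, `‖α‖ = 1` by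
`Negative.NormOne`, chart core of p125317) gives `s₀ > 0` at `t₀` (here `t₀ ∈ G` is used) and an analytic
`S = L ∘ g_D` near `t₀` with `g_{R'}(u n) = F(M_{R'}(α(S(u n))))`; the identity theorem on an interval
`(t₀ - r₀, t₀ + r₀) ∩ [0,1]` (its length set by the diamond only) identifies `g_{R'} = F ∘ M_{R'} ∘ α ∘ S` there
for every RECTILINEAR `R'`; (W) `HeatFlow.cardyLimit_of_rectilinear` (p137344) upgrades to every conformal
rectangle, so the whole interval is good. -/
theorem stub_accumulationInteriorOfTameAnalyticity :
    (∀ (t₀ : unitInterval) (R : ConformalRectangle),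
      (∃ S : Finset (ℂ × ℂ), frontier R.carrier ⊆ ⋃ p ∈ S, segment ℝ p.1 p.2) →
      ∃ r > 0, ∃ δ₁ > 0, ∃ C : ℝ, ∀ δ : ℝ, 0 < δ → δ < δ₁ → ∀ p : Polynomial ℝ,
        (∀ t : unitInterval, Percolation.cornerCrossingProb t R δ = p.eval (t : ℝ)) →
        ∀ z ∈ Metric.ball ((t₀ : ℝ) : ℂ) r, ‖(p.map (algebraMap ℝ ℂ)).eval z‖ ≤ C) →
    ∀ t₀ ∈ {t : unitInterval | ∃ α : ℂ, 0 < α.im ∧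
        ∀ (R R' : ConformalRectangle)
          (φ : ConformalEquiv UpperHalfPlane.upperHalfPlaneSet R.carrier) (x : Fin 4 → ℝ),
          R.carrier = moduliShear α '' R'.carrier → (∀ i, R.pt i = moduliShear α (R'.pt i)) →
          R.IsUniformizing φ x →
          Tendsto (Percolation.cornerCrossingProb t R') (𝓝[>] 0)
            (𝓝 (RandomPlanarGeometry.cardyFunction (RandomPlanarGeometry.crossRatio x)))},
      AccPt t₀ (𝓟 {t : unitInterval | ∃ α : ℂ, 0 < α.im ∧
        ∀ (R R' : ConformalRectangle)
          (φ : ConformalEquiv UpperHalfPlane.upperHalfPlaneSet R.carrier) (x : Fin 4 → ℝ),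
          R.carrier = moduliShear α '' R'.carrier → (∀ i, R.pt i = moduliShear α (R'.pt i)) →
          R.IsUniformizing φ x →
          Tendsto (Percolation.cornerCrossingProb t R') (𝓝[>] 0)
            (𝓝 (RandomPlanarGeometry.cardyFunction (RandomPlanarGeometry.crossRatio x)))}) →
      t₀ ∈ interior {t : unitInterval | ∃ α : ℂ, 0 < α.im ∧
        ∀ (R R' : ConformalRectangle)
          (φ : ConformalEquiv UpperHalfPlane.upperHalfPlaneSet R.carrier) (x : Fin 4 → ℝ),
          R.carrier = moduliShear α '' R'.carrier → (∀ i, R.pt i = moduliShear α (R'.pt i)) →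
          R.IsUniformizing φ x →
          Tendsto (Percolation.cornerCrossingProb t R') (𝓝[>] 0)
            (𝓝 (RandomPlanarGeometry.cardyFunction (RandomPlanarGeometry.crossRatio x)))} := by
  sorry

/-- NGT (provable glue; wave 1).  NEAR-SMIRNOV FROM TAME JETS, WITHOUT A UNIFORM-IN-`R` RADIUS: from the RECTILINEAR
local complex bounds at EVERY `t₀ ∈ [0,1]` with `R`-dependent radii (verbatim reshape 8's S4wR, implied by S4wP),
jet convergence at `0` (JCR) and a local jet-identification germ (JIR₀, radius `r₀` uniform in `R'`), every
`t < ε` is a good point, for ONE `ε > 0`.  Route (adaptation of GJ `tendsto_eval_of_globalJets`, p134197, and of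
the strategist's `NearSmirnov_of`): for a rectilinear `R'`, compactness of `[0,1]` turns S4wR into a disc-chain
neighbourhood `U ⊇ [0,1]` with a common mesh threshold and bound; Vitali with jets (VJ `stub_vitaliJets`,
p132875) gives a holomorphic limit `g` on `U` whose jets at `0` are `k! a_k`; the power series `Σ a_k t^k`
converges on `[0, r₀)` (JIR₀), so its sum `h` is real-analytic on `(-r₀, r₀)` and equals `re g` near `0⁺`
(Taylor), hence on `[0, r₀)` (identity theorem on the preconnected `Ico 0 r₀`); so `P_t(R', δ) → F(M(α t))` for
every `t < r₀` and every rectilinear `R'`, and (W) `HeatFlow.cardyLimit_of_rectilinear` (p137344) upgrades the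
rectilinear limits to every conformal rectangle: `t ∈ G` with modulus `α t`.  Take `ε = r₀`. -/
theorem stub_nearGoodOfTameJets :
    (∀ (t₀ : unitInterval) (R : ConformalRectangle),
      (∃ S : Finset (ℂ × ℂ), (∀ p ∈ S, p.1.re = p.2.re ∨ p.1.im = p.2.im) ∧
        frontier R.carrier ⊆ ⋃ p ∈ S, segment ℝ p.1 p.2) →
      ∃ r > 0, ∃ δ₁ > 0, ∃ C : ℝ, ∀ δ : ℝ, 0 < δ → δ < δ₁ → ∀ p : Polynomial ℝ,
        (∀ t : unitInterval, Percolation.cornerCrossingProb t R δ = p.eval (t : ℝ)) →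
        ∀ z ∈ Metric.ball ((t₀ : ℝ) : ℂ) r, ‖(p.map (algebraMap ℝ ℂ)).eval z‖ ≤ C) →
    (∀ R' : ConformalRectangle,
      (∃ S : Finset (ℂ × ℂ), (∀ p ∈ S, p.1.re = p.2.re ∨ p.1.im = p.2.im) ∧
        frontier R'.carrier ⊆ ⋃ p ∈ S, segment ℝ p.1 p.2) →
      ∀ k : ℕ, ∃ a : ℝ, ∀ ε > 0, ∃ δ₀ > 0, ∀ δ : ℝ, 0 < δ → δ < δ₀ → ∀ p : Polynomial ℝ,
        (∀ t : unitInterval, Percolation.cornerCrossingProb t R' δ = p.eval (t : ℝ)) →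
        |p.coeff k - a| < ε) →
    (∃ r₀ > 0, ∃ α : unitInterval → ℂ, (∀ t : unitInterval, (t : ℝ) < r₀ → 0 < (α t).im) ∧
      ∀ R' : ConformalRectangle,
        (∃ S : Finset (ℂ × ℂ), (∀ p ∈ S, p.1.re = p.2.re ∨ p.1.im = p.2.im) ∧
          frontier R'.carrier ⊆ ⋃ p ∈ S, segment ℝ p.1 p.2) →
        ∀ M : ℂ → ℝ, AnalyticOnNhd ℝ M {β : ℂ | 0 < β.im} →
          (∀ β : ℂ, 0 < β.im → ∀ (R : ConformalRectangle)
              (φ : ConformalEquiv UpperHalfPlane.upperHalfPlaneSet R.carrier) (x : Fin 4 → ℝ),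
              R.carrier = moduliShear β '' R'.carrier → (∀ i, R.pt i = moduliShear β (R'.pt i)) →
              R.IsUniformizing φ x → RandomPlanarGeometry.crossRatio x = M β) →
          ∀ a : ℕ → ℝ,
            (∀ k : ℕ, ∀ ε > 0, ∃ δ₀ > 0, ∀ δ : ℝ, 0 < δ → δ < δ₀ → ∀ p : Polynomial ℝ,
                (∀ t : unitInterval, Percolation.cornerCrossingProb t R' δ = p.eval (t : ℝ)) →
                |p.coeff k - a k| < ε) →
            ∀ t : unitInterval, (t : ℝ) < r₀ →
              HasSum (fun k : ℕ => a k * (t : ℝ) ^ k) (RandomPlanarGeometry.cardyFunction (M (α t)))) →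
    ∃ ε > 0, ∀ t : unitInterval, (t : ℝ) < ε →
      t ∈ {t : unitInterval | ∃ α : ℂ, 0 < α.im ∧
        ∀ (R R' : ConformalRectangle)
          (φ : ConformalEquiv UpperHalfPlane.upperHalfPlaneSet R.carrier) (x : Fin 4 → ℝ),
          R.carrier = moduliShear α '' R'.carrier → (∀ i, R.pt i = moduliShear α (R'.pt i)) →
          R.IsUniformizing φ x →
          Tendsto (Percolation.cornerCrossingProb t R') (𝓝[>] 0)
            (𝓝 (RandomPlanarGeometry.cardyFunction (RandomPlanarGeometry.crossRatio x)))} := by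
  sorry

namespace SegmentOpenSketch

/-! ## Vocabulary for the glue (reducible abbreviations of the route's `let` blocks) -/

/-- `CardyMod t α` of the route, over `Percolation.cornerCrossingProb` (= the route's `P`). -/
abbrev CardyModAt (t : unitInterval) (α : ℂ) : Prop :=
  ∀ (R R' : ConformalRectangle)
    (φ : ConformalEquiv UpperHalfPlane.upperHalfPlaneSet R.carrier) (x : Fin 4 → ℝ),
    R.carrier = moduliShear α '' R'.carrier → (∀ i, R.pt i = moduliShear α (R'.pt i)) →
    R.IsUniformizing φ x →
    Tendsto (Percolation.cornerCrossingProb t R') (𝓝[>] 0)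
      (𝓝 (RandomPlanarGeometry.cardyFunction (RandomPlanarGeometry.crossRatio x)))

/-- The route's good set `G = {t | ∃ α, 0 < Im α ∧ CardyMod t α}`. -/
abbrev goodSet : Set unitInterval := {t | ∃ α : ℂ, 0 < α.im ∧ CardyModAt t α}

/-- The route's `UniformMarginality` body (the hypothesis of `SegmentOpen`; used for closedness of `G`). -/
abbrev UM : Prop :=
  ∀ (t₀ : unitInterval) (R : ConformalRectangle) (ε : ℝ), 0 < ε → ∃ η > 0, ∀ t : unitInterval,
    dist t t₀ < η → ∀ δ : ℝ, 0 < δ →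
      |Percolation.cornerCrossingProb t R δ - Percolation.cornerCrossingProb t₀ R δ| < ε

/-- "Rectilinear": the boundary is covered by finitely many axis-parallel segments (as in (W)). -/
abbrev IsRectilinear (R : ConformalRectangle) : Prop :=
  ∃ S : Finset (ℂ × ℂ), (∀ p ∈ S, p.1.re = p.2.re ∨ p.1.im = p.2.im) ∧
    frontier R.carrier ⊆ ⋃ p ∈ S, segment ℝ p.1 p.2

/-- "Polygonal": the boundary is covered by finitely many straight segments. -/
abbrev IsPolygonal (R : ConformalRectangle) : Prop :=
  ∃ S : Finset (ℂ × ℂ), frontier R.carrier ⊆ ⋃ p ∈ S, segment ℝ p.1 p.2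

/-- Local mesh-uniform complex bound of the crossing polynomials of `R` at `t₀` (the common matrix of S4w*). -/
abbrev LocalComplexBoundAt (t₀ : unitInterval) (R : ConformalRectangle) : Prop :=
  ∃ r > 0, ∃ δ₁ > 0, ∃ C : ℝ, ∀ δ : ℝ, 0 < δ → δ < δ₁ → ∀ p : Polynomial ℝ,
    (∀ t : unitInterval, Percolation.cornerCrossingProb t R δ = p.eval (t : ℝ)) →
    ∀ z ∈ Metric.ball ((t₀ : ℝ) : ℂ) r, ‖(p.map (algebraMap ℝ ℂ)).eval z‖ ≤ C

/-- Child 1 of the split over the glue vocabulary: a right-neighbourhood of the Smirnov point is good. -/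
abbrev NearSmirnovProp : Prop := ∃ ε > 0, ∀ t : unitInterval, (t : ℝ) < ε → t ∈ goodSet

/-- Child 2 of the split over the glue vocabulary: the Smirnov germ plus UM propagate openness. -/
abbrev GermPropagationProp : Prop := NearSmirnovProp → UM → IsOpen goodSet

/-! ## Glue (proved) -/

/-- The route's `SegmentOpen` unfolds (zeta/delta) to `UM → IsOpen goodSet`. -/
theorem segmentOpen_iff :
    Summit.CriticalPhenomena.CardyFormulaZ2.Theses.CardySelfDualSegment.SegmentOpen ↔
      (UM → IsOpen goodSet) := Iff.rfl

/-- A rectilinear conformal rectangle is polygonal (drop the axis-parallel conjunct): S4wP ⊢ S4wR. -/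
theorem localComplexBoundRect_of_polygonal
    (h : ∀ (t₀ : unitInterval) (R : ConformalRectangle), IsPolygonal R → LocalComplexBoundAt t₀ R) :
    ∀ (t₀ : unitInterval) (R : ConformalRectangle), IsRectilinear R → LocalComplexBoundAt t₀ R :=
  fun t₀ R ⟨S, _, hS⟩ => h t₀ R ⟨S, hS⟩

/-- **CHILD 1 from the stubs: `NearSmirnov`** (S4wP|rect + JCR + JIR₀ through NGT). -/
theorem nearSmirnov_of_stubs : NearSmirnovProp :=
  stub_nearGoodOfTameJets (localComplexBoundRect_of_polygonal stub_localComplexBoundPolygonal)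
    stub_jetConvRect stub_jetIdentificationRectLocal

/-- A right-neighbourhood of `0` inside `G` makes `0` an accumulation point of `G`. -/
theorem accPt_zero_of_near (h : NearSmirnovProp) : AccPt (0 : unitInterval) (𝓟 goodSet) := by
  -- adapted from Cruxes/SegmentOpen/SplitR1_GermPropagationBirth.lean (strategist r1)
  obtain ⟨ε, hε, hG⟩ := h
  have hopen : IsOpen {t : unitInterval | (t : ℝ) < ε} :=
    isOpen_lt continuous_subtype_val continuous_const
  have h0 : (0 : unitInterval) ∈ {t : unitInterval | (t : ℝ) < ε} := by simpa using hε
  exact (accPt_principal_of_isOpen_unitInterval hopen h0).mono (principal_mono.2 fun t ht => hG t ht)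

/-- `G` is closed under UM: the PROVED sibling crux `SegmentClosed` (`segmentClosed_proof`) fed by UBC. -/
theorem isClosed_goodSet_of_UM (hUM : UM) : IsClosed goodSet :=
  (segmentClosed_iff.1 segmentClosed_proof) stub_uniformBoxCrossing hUM

/-- Under UM the stubs give `G = [0,1]`: `G` closed, accumulation ⇒ interior at good points (AIT fed by S4wP),
`0` accumulates (child 1) ⇒ clopen sweep. -/
theorem goodSet_eq_univ_of_stubs (hUM : UM) : goodSet = univ :=
  SmirnovGerm.eq_univ_of_isClosed_of_accPt (isClosed_goodSet_of_UM hUM)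
    (fun t ht hacc => stub_accumulationInteriorOfTameAnalyticity stub_localComplexBoundPolygonal t ht hacc)
    (accPt_zero_of_near nearSmirnov_of_stubs)

/-- **CHILD 2 from the stubs: `GermPropagation`** (S4wP + UBC + AIT): `G` closed, accumulation ⇒ interior at
good points, `0` accumulates ⇒ `G = [0,1]` (clopen sweep), which is open. -/
theorem germPropagation_of_stubs : GermPropagationProp := by
  intro hnear hUM
  have huniv : goodSet = univ :=
    SmirnovGerm.eq_univ_of_isClosed_of_accPt (isClosed_goodSet_of_UM hUM)
      (fun t ht hacc => stub_accumulationInteriorOfTameAnalyticity stub_localComplexBoundPolygonal t ht hacc)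
      (accPt_zero_of_near hnear)
  rw [huniv]
  exact isOpen_univ

/-- COMPOSITION (reshape 9, split form): `SegmentOpen ⇐ NearSmirnov ∧ GermPropagation` — modus ponens. -/
theorem segmentOpen_of_stubs :
    Summit.CriticalPhenomena.CardyFormulaZ2.Theses.CardySelfDualSegment.SegmentOpen :=
  segmentOpen_iff.2 (germPropagation_of_stubs nearSmirnov_of_stubs)

/-- The same stubs prove the route's `Target` under the crux hypothesis UM (`G = [0,1]` pointwise). -/
theorem target_of_stubs (hUM : UM) :
    Summit.CriticalPhenomena.CardyFormulaZ2.Theses.CardySelfDualSegment.Target :=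
  target_iff_forall_mem_goodSet.2 fun t => by
    have h : t ∈ goodSet := by
      rw [goodSet_eq_univ_of_stubs hUM]
      exact mem_univ t
    exact h

end SegmentOpenSketch

end Summit.CriticalPhenomena.CardyFormulaZ2.Theorems
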